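import Summits.HodgeConjecture.HodgeConjecture.Theorems.PadicSemiregularLiftHodgeFermatVarietiesTwinLocal
import Summits.HodgeConjecture.HodgeConjecture.Theorems.PadicSemiregularLiftHodgeFermatVarietiesTwinProgression
import HarnessLib

/-!
# Even, or a progression fibre at `5` or at `7`: the TWIN boundary brick (T6-L1) — line `cancel-by-any-claim-lattice`, crux `HodgeFermatVarieties` (stmt-HodgeConjecture-1334)

Lead c4's programme T6, stub T6-L1 `stub_fibre_of_boundary_twin` (skeleton generation 16; the SEXTUPLE TWIN CORE
`35 ∣ m`). Let `T : ℤ/(5^a 7^b n) → ℕ` (`a, b ≥ 1`, `(a, b, n) ≠ (1, 1, 1)`, `n` prime to `35` with all primes `≥ 5`)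
be supported on units, annihilated by every odd primitive character, with room `#supp T + 1 < p'` at every prime
`p' ∣ n` and with total mass `Σ T ≤ 6`. Then `T` is EVEN, or for `p₁ = 5` or `p₁ = 7` all but at most one of the `p₁`
points `x₀ + j (5^a7^bn/p₁)` of a progression through a unit `x₀` lie in `supp T`.

Proof (`progression_of_pos_diff`, `even_or_progression_of_boundary_twin`): if `T` is not even, cut the piece `Tp` of
`T` around a unit `z₀` with `T(z₀) ≠ T(−z₀)` (`piece_annihilated_odd`); on the fibre of the second coordinate `b` of
`±z₀` the differences `D(a) = Tp(crt⁻¹(a, b)) − Tp(−crt⁻¹(a, b))` have the OUTER-SUM structure of `twin_delta` on the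
kernel blocks `U₅ × U₇` (`U₅ = ker → 5^{a−1}7^b`, `U₇ = ker → 5^a7^{b−1}`); at the point `y` of `±z₀` with `D(y) ≥ 1`
either the whole `U₅`-coset or the whole `U₇`-coset through `y` has `D ≥ 1` — hence `Tp ≥ 1`, a kernel coset inside
`supp T`, which is a progression (`apply_kernel_crt`, `progression_of_kernel_coset`) — or three rows of the block
carry mass `≥ 7` (`seven_le_sum_abs_of_delta`), while their mass is at most `Σ T ≤ 6` (`sum_three_rows_le_sum_abs`;
for `n = 1` the rows and their negatives give `14 ≤ 12`, `two_mul_sum_three_rows_le_sum_abs`, `−1 ∉ U₇U₅` as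
`(a, b) ≠ (1, 1)`). Everything here is proved; no named facts.

References: [Aoki1983] N. Aoki, Math. Ann. 266 (1983) 23–54, Prop. 6.4, Lemma 4.4 and §9.
-/

-- every sibling file of the line declares into `…CancelByAnyClaimLattice.PairedNull` from a differently named module
set_option linter.dupNamespace false

noncomputable section
open Finset
open Literature.AlgebraicGeometry.HodgeTheory Literature.AlgebraicGeometry.HodgeTheory.FermatCharacter

namespace Summit.HodgeConjecture.HodgeConjecture.Theorems.CancelByAnyClaimLattice

namespace PairedNull
section Twin
variable {a b n : ℕ} [NeZero n]

/-- `πq[p']` — reduction from level `5^a7^b · n` to the prime power `p' ^ v_{p'}(n)` of `n`. Local notation. -/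
local notation3 (prettyPrint := false) "πq[" p' "]" =>
  ZMod.castHom ((Nat.ordProj_dvd n p').trans (dvd_mul_left n (5 ^ a * 7 ^ b))) (ZMod (p' ^ n.factorization p'))

/-- `Reg[P, x, z]` — `z` lies in the region of `x` at the primes of `P`. Local notation. -/
local notation3 (prettyPrint := false) "Reg[" P ", " x ", " z "]" =>
  ∀ p' ∈ (P : Finset ℕ), πq[p'] z = πq[p'] x ∨ πq[p'] z = -(πq[p'] x)

/-- `crt[hc, y, c]` — the point with coordinates `(y, c)`. Local notation. -/
local notation3 (prettyPrint := false) "crt[" hc ", " y ", " c "]" => (ZMod.chineseRemainder hc).symm (y, c)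

/-- Kernel conditions do not depend on how the divisor is written. [folklore] -/
theorem unitsMap_eq_one_iff_of_eq {q d d' : ℕ} (h : d = d') (hd : d ∣ q) (hd' : d' ∣ q) (u : (ZMod q)ˣ) :
    ZMod.unitsMap hd u = 1 ↔ ZMod.unitsMap hd' u = 1 := by
  subst h; rfl

/-- The two fibres `{crt⁻¹(a, b)}` and `{−crt⁻¹(a, b)}` of an `ℕ`-valued function carry at most its total mass (when
`b ≠ −b` they are disjoint) — resp. at most twice it (in general). [folklore] -/
theorem sum_fibres_le [NeZero (5 ^ a * 7 ^ b)] (hc : (5 ^ a * 7 ^ b).Coprime n) (F : ZMod (5 ^ a * 7 ^ b * n) → ℕ)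
    (b₀ : ZMod n) :
    (b₀ ≠ -b₀ → ∑ y : ZMod (5 ^ a * 7 ^ b), (F (crt[hc, y, b₀]) + F (-(crt[hc, y, b₀]))) ≤
        ∑ z : ZMod (5 ^ a * 7 ^ b * n), F z) ∧
      ∑ y : ZMod (5 ^ a * 7 ^ b), (F (crt[hc, y, b₀]) + F (-(crt[hc, y, b₀]))) ≤
        2 * ∑ z : ZMod (5 ^ a * 7 ^ b * n), F z := by
  classical
  set S₁ : Finset (ZMod (5 ^ a * 7 ^ b * n)) := univ.image fun y ↦ crt[hc, y, b₀] with hS₁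
  set S₂ : Finset (ZMod (5 ^ a * 7 ^ b * n)) := univ.image fun y ↦ -(crt[hc, y, b₀]) with hS₂
  have hinj₁ : Function.Injective fun y : ZMod (5 ^ a * 7 ^ b) ↦ crt[hc, y, b₀] := by
    intro y y' h
    have := (ZMod.chineseRemainder hc).symm.injective h
    exact (Prod.mk.inj this).1
  have hinj₂ : Function.Injective fun y : ZMod (5 ^ a * 7 ^ b) ↦ -(crt[hc, y, b₀]) :=
    fun y y' h ↦ hinj₁ (neg_injective h)
  have h₁ : ∑ y : ZMod (5 ^ a * 7 ^ b), F (crt[hc, y, b₀]) = ∑ z ∈ S₁, F z := by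
    rw [hS₁, Finset.sum_image (fun y _ y' _ h ↦ hinj₁ h)]
  have h₂ : ∑ y : ZMod (5 ^ a * 7 ^ b), F (-(crt[hc, y, b₀])) = ∑ z ∈ S₂, F z := by
    rw [hS₂, Finset.sum_image (fun y _ y' _ h ↦ hinj₂ h)]
  have hle₁ : ∑ z ∈ S₁, F z ≤ ∑ z, F z := Finset.sum_le_sum_of_subset_of_nonneg (subset_univ _) fun _ _ _ ↦ Nat.zero_le _
  have hle₂ : ∑ z ∈ S₂, F z ≤ ∑ z, F z := Finset.sum_le_sum_of_subset_of_nonneg (subset_univ _) fun _ _ _ ↦ Nat.zero_le _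
  rw [Finset.sum_add_distrib, h₁, h₂]
  refine ⟨fun hb ↦ ?_, by omega⟩
  have hdisj : Disjoint S₁ S₂ := by
    rw [Finset.disjoint_left]
    intro z hz hz'
    obtain ⟨y, -, hy⟩ := mem_image.mp hz
    obtain ⟨y', -, hy'⟩ := mem_image.mp hz'
    have hEq : (ZMod.chineseRemainder hc).symm (-y', -b₀) = (ZMod.chineseRemainder hc).symm (y, b₀) := by
      rw [crt_symm_neg]; exact hy'.trans hy.symm
    have h2 := (Prod.mk.inj ((ZMod.chineseRemainder hc).symm.injective hEq)).2
    exact hb (neg_eq_iff_eq_neg.mp h2)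
  rw [← Finset.sum_union hdisj]
  exact Finset.sum_le_sum_of_subset_of_nonneg (subset_univ _) fun _ _ _ ↦ Nat.zero_le _

/-- **The core of the twin brick: a positive difference forces a kernel-coset fibre at `5` or at `7`.** Let
`F : ℤ/(5^a7^bn) → ℕ` (`a, b ≥ 1`, `(a, b, n) ≠ (1, 1, 1)`, primes of `n` `≥ 5`) be annihilated (as a `ℂ`-valued function)
by the odd primitive characters, supported on units inside one sign region, of mass `≤ 6`, and let `b₀` be a unit mod
`n` and `y` a unit mod `5^a7^b` with `F(−crt⁻¹(y, b₀)) < F(crt⁻¹(y, b₀))`. Then for `p₁ = 5` or `p₁ = 7` all but at most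
one of the `p₁` points `x₀ + j(5^a7^bn/p₁)` through some unit `x₀` lie in `supp F`. [cite: Aoki1983, Prop. 6.4 and §9] -/
theorem progression_of_pos_diff [NeZero (5 ^ a * 7 ^ b)] (ha : 1 ≤ a) (hb : 1 ≤ b) (habn : ¬ (a = 1 ∧ b = 1 ∧ n = 1))
    (hn5 : ∀ p' ∈ n.primeFactors, 5 ≤ p') (hc : (5 ^ a * 7 ^ b).Coprime n)
    (F : ZMod (5 ^ a * 7 ^ b * n) → ℕ)
    (hFann : ∀ χ : DirichletCharacter ℂ (5 ^ a * 7 ^ b * n), χ.Odd → χ.IsPrimitive →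
      ∑ z : ZMod (5 ^ a * 7 ^ b * n), (F z : ℂ) * χ z = 0)
    {x : ZMod (5 ^ a * 7 ^ b * n)} (hx : IsUnit x)
    (hFsupp : ∀ z, (F z : ℂ) ≠ 0 → IsUnit z ∧ Reg[n.primeFactors, x, z])
    (hFmass : ∑ z : ZMod (5 ^ a * 7 ^ b * n), F z ≤ 6)
    (b₀ : ZMod n) (hb₀ : IsUnit b₀) (y : (ZMod (5 ^ a * 7 ^ b))ˣ)
    (hpos : F (-(crt[hc, (y : ZMod (5 ^ a * 7 ^ b)), b₀])) < F (crt[hc, (y : ZMod (5 ^ a * 7 ^ b)), b₀])) :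
    ∃ p₁ : ℕ, (p₁ = 5 ∨ p₁ = 7) ∧ ∃ x₀ : ZMod (5 ^ a * 7 ^ b * n), IsUnit x₀ ∧ ∃ j₀ : ℕ, j₀ < p₁ ∧
      ∀ j : ℕ, j < p₁ → j ≠ j₀ →
        F (x₀ + (j : ZMod (5 ^ a * 7 ^ b * n)) * ((5 ^ a * 7 ^ b * n / p₁ : ℕ) : ZMod (5 ^ a * 7 ^ b * n))) ≠ 0 := by
  classical
  haveI : NeZero (5 ^ a * 7 ^ b * n) := ⟨mul_ne_zero (NeZero.ne _) (NeZero.ne n)⟩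
  -- the two kernels
  have hd₅ : 5 ^ (a - 1) * 7 ^ b ∣ 5 ^ a * 7 ^ b := Nat.mul_dvd_mul (pow_dvd_pow 5 (Nat.sub_le a 1)) dvd_rfl
  have hd₇ : 5 ^ a * 7 ^ (b - 1) ∣ 5 ^ a * 7 ^ b := Nat.mul_dvd_mul dvd_rfl (pow_dvd_pow 7 (Nat.sub_le b 1))
  have hprim := fun χ h5 h7 ↦ isPrimitive_of_not_factorsThrough_twin ha hb χ h5 h7
  -- the integer-valued differences on the fibre of `b₀`
  set Dz : ZMod (5 ^ a * 7 ^ b) → ℤ := fun y' ↦ (F (crt[hc, y', b₀]) : ℤ) - (F (-(crt[hc, y', b₀])) : ℤ) with hDz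
  have hΔ : ∀ u v y' : (ZMod (5 ^ a * 7 ^ b))ˣ, ZMod.unitsMap hd₅ u = 1 → ZMod.unitsMap hd₇ v = 1 →
      Dz ((v : ZMod (5 ^ a * 7 ^ b)) * ((u : ZMod (5 ^ a * 7 ^ b)) * y')) - Dz ((u : ZMod (5 ^ a * 7 ^ b)) * y') =
        Dz ((v : ZMod (5 ^ a * 7 ^ b)) * y') - Dz y' := by
    intro u v y' hu hv
    have h := twin_delta hc hn5 (fun z ↦ (F z : ℂ)) hFann hx hFsupp b₀ hd₅ hd₇ hprim u v y' hu hv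
    have h' : ((Dz ((v : ZMod (5 ^ a * 7 ^ b)) * ((u : ZMod (5 ^ a * 7 ^ b)) * y')) -
        Dz ((u : ZMod (5 ^ a * 7 ^ b)) * y') : ℤ) : ℂ) = ((Dz ((v : ZMod (5 ^ a * 7 ^ b)) * y') - Dz y' : ℤ) : ℂ) := by
      simp only [hDz]; push_cast; linear_combination h
    exact_mod_cast h'
  have hy : 1 ≤ Dz y := by simp only [hDz]; omega
  -- a kernel coset with `Dz ≥ 1` is a progression inside `supp F`
  have hq5 : 5 ^ a * 7 ^ b / 5 = 5 ^ (a - 1) * 7 ^ b := by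
    rw [show 5 ^ a = 5 * 5 ^ (a - 1) by rw [← pow_succ']; congr 1; omega, mul_assoc, Nat.mul_div_cancel_left _ (by norm_num)]
  have hq7 : 5 ^ a * 7 ^ b / 7 = 5 ^ a * 7 ^ (b - 1) := by
    rw [show 7 ^ b = 7 * 7 ^ (b - 1) by rw [← pow_succ']; congr 1; omega, Nat.mul_left_comm,
      Nat.mul_div_cancel_left _ (by norm_num)]
  have hout : ∀ (p₁ d : ℕ), p₁.Prime → (p₁ = 5 ∨ p₁ = 7) → (hdq : d ∣ 5 ^ a * 7 ^ b) → 5 ^ a * 7 ^ b / p₁ = d →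
      (∀ u : (ZMod (5 ^ a * 7 ^ b))ˣ, ZMod.unitsMap hdq u = 1 → 1 ≤ Dz ((u : ZMod (5 ^ a * 7 ^ b)) * y)) →
      ∃ x₀ : ZMod (5 ^ a * 7 ^ b * n), IsUnit x₀ ∧ ∃ j₀ : ℕ, j₀ < p₁ ∧ ∀ j : ℕ, j < p₁ → j ≠ j₀ →
        F (x₀ + (j : ZMod (5 ^ a * 7 ^ b * n)) * ((5 ^ a * 7 ^ b * n / p₁ : ℕ) : ZMod (5 ^ a * 7 ^ b * n))) ≠ 0 := by
    intro p₁ d hp₁ hp57 hdq hqd hU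
    have hpq : p₁ ∣ 5 ^ a * 7 ^ b := by
      rcases hp57 with rfl | rfl
      · exact (dvd_pow_self 5 (by omega)).trans (dvd_mul_right _ _)
      · exact (dvd_pow_self 7 (by omega)).trans (dvd_mul_left _ _)
    have hdq' : 5 ^ a * 7 ^ b / p₁ ∣ 5 ^ a * 7 ^ b := Nat.div_dvd_of_dvd hpq
    have hNdiv : 5 ^ a * 7 ^ b * n / p₁ = 5 ^ a * 7 ^ b / p₁ * n := (Nat.div_mul_right_comm hpq n).symm
    have hdN : 5 ^ a * 7 ^ b * n / p₁ ∣ 5 ^ a * 7 ^ b * n := Nat.div_dvd_of_dvd (hpq.trans (dvd_mul_right _ _))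
    have hdd : 5 ^ a * 7 ^ b / p₁ ∣ 5 ^ a * 7 ^ b * n / p₁ := by rw [hNdiv]; exact dvd_mul_right _ _
    have hnd : n ∣ 5 ^ a * 7 ^ b * n / p₁ := by rw [hNdiv]; exact dvd_mul_left _ _
    have hker : ∀ u : (ZMod (5 ^ a * 7 ^ b))ˣ, ZMod.unitsMap hdq' u = 1 →
        (F (crt[hc, (u : ZMod (5 ^ a * 7 ^ b)) * y, b₀]) : ℂ) ≠ 0 := by
      intro u hu
      have hu' : ZMod.unitsMap hdq u = 1 := (unitsMap_eq_one_iff_of_eq hqd hdq' hdq u).mp hu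
      have h1 := hU u hu'
      have h2 : 1 ≤ F (crt[hc, (u : ZMod (5 ^ a * 7 ^ b)) * y, b₀]) := by simp only [hDz] at h1; omega
      exact_mod_cast show F (crt[hc, (u : ZMod (5 ^ a * 7 ^ b)) * y, b₀]) ≠ 0 by omega
    have hw := apply_kernel_crt hc hdq' hdN hdd hnd (fun z ↦ (F z : ℂ)) y b₀ hker
    set x₀ : ZMod (5 ^ a * 7 ^ b * n) := crt[hc, (y : ZMod (5 ^ a * 7 ^ b)), b₀] with hx₀
    have hx₀u : IsUnit x₀ := (isUnit_crt_symm_iff hc _ _).mpr ⟨Units.isUnit y, hb₀⟩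
    obtain ⟨j₀, hj₀, hprog⟩ := progression_of_kernel_coset hp₁ (hpq.trans (dvd_mul_right _ _)) hdN
      (fun z ↦ (F z : ℂ) ≠ 0) hx₀u.unit (fun w hw' ↦ by rw [IsUnit.unit_spec]; exact hw w hw')
    refine ⟨x₀, hx₀u, j₀, hj₀, fun j hj hne ↦ ?_⟩
    have := hprog j hj hne
    rw [IsUnit.unit_spec] at this
    exact_mod_cast this
  by_cases hU5 : ∀ u : (ZMod (5 ^ a * 7 ^ b))ˣ, ZMod.unitsMap hd₅ u = 1 → 1 ≤ Dz ((u : ZMod (5 ^ a * 7 ^ b)) * y)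
  · exact ⟨5, Or.inl rfl, hout 5 _ Nat.prime_five (Or.inl rfl) hd₅ hq5 hU5⟩
  by_cases hU7 : ∀ v : (ZMod (5 ^ a * 7 ^ b))ˣ, ZMod.unitsMap hd₇ v = 1 → 1 ≤ Dz ((v : ZMod (5 ^ a * 7 ^ b)) * y)
  · exact ⟨7, Or.inr rfl, hout 7 _ (by decide) (Or.inr rfl) hd₇ hq7 hU7⟩
  -- otherwise three rows of the kernel block carry mass ≥ 7, more than the total mass allows
  exfalso
  push Not at hU5 hU7
  obtain ⟨u₁, hu₁, hDu₁⟩ := hU5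
  obtain ⟨v₁, hv₁, hDv₁⟩ := hU7
  have hv₁1 : v₁ ≠ 1 := by rintro rfl; rw [Units.val_one, one_mul] at hDv₁; omega
  have hu₁1 : u₁ ≠ 1 := by rintro rfl; rw [Units.val_one, one_mul] at hDu₁; omega
  -- a third element `u₂` of the kernel at `5`
  obtain ⟨u₂, hu₂K, hu₂⟩ : ∃ u₂, u₂ ∈ univ.filter (fun u : (ZMod (5 ^ a * 7 ^ b))ˣ ↦ ZMod.unitsMap hd₅ u = 1) ∧
      u₂ ∉ ({1, u₁} : Finset (ZMod (5 ^ a * 7 ^ b))ˣ) :=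
    Finset.exists_mem_notMem_of_card_lt_card
      (lt_of_lt_of_le (lt_of_le_of_lt (Finset.card_le_two) (by norm_num)) (three_le_card_ker_five ha hb hd₅))
  have hu₂ker : ZMod.unitsMap hd₅ u₂ = 1 := (mem_filter.mp hu₂K).2
  have h02 : u₂ ≠ 1 := fun h ↦ hu₂ (by rw [h]; exact mem_insert_self _ _)
  have h12 : u₁ ≠ u₂ := fun h ↦ hu₂ (by rw [← h]; exact mem_insert_of_mem (mem_singleton_self _))
  have hseven := seven_le_sum_abs_of_delta hd₅ hd₇ hΔ y u₁ u₂ v₁ hu₁ hu₂ker hv₁ hv₁1 hy (by omega) (by omega)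
    (six_le_card_ker_seven ha hb hd₇)
  have hkk := eq_one_of_mem_ker_five_seven (a := a) (b := b) hd₅ hd₇
  -- mass of the units ≤ mass of all of `ℤ/5^a7^b` ≤ the two fibres
  have hunits : ∑ u : (ZMod (5 ^ a * 7 ^ b))ˣ, |Dz (u : ZMod (5 ^ a * 7 ^ b))| ≤
      ∑ y' : ZMod (5 ^ a * 7 ^ b), |Dz y'| := by
    rw [← Finset.sum_image (f := fun y' ↦ |Dz y'|) (fun u _ u' _ h ↦ Units.ext h)]
    exact Finset.sum_le_sum_of_subset_of_nonneg (subset_univ _) fun _ _ _ ↦ abs_nonneg _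
  have habs : ∑ y' : ZMod (5 ^ a * 7 ^ b), |Dz y'| ≤
      ((∑ y' : ZMod (5 ^ a * 7 ^ b), (F (crt[hc, y', b₀]) + F (-(crt[hc, y', b₀]))) : ℕ) : ℤ) := by
    push_cast
    refine Finset.sum_le_sum fun y' _ ↦ ?_
    simp only [hDz]
    have h1 := abs_sub (F (crt[hc, y', b₀]) : ℤ) (F (-(crt[hc, y', b₀])) : ℤ)
    rwa [abs_of_nonneg (Int.natCast_nonneg (F (crt[hc, y', b₀]))),
      abs_of_nonneg (Int.natCast_nonneg (F (-(crt[hc, y', b₀]))))] at h1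
  obtain ⟨hfib₁, hfib₂⟩ := sum_fibres_le hc F b₀
  by_cases hbb : b₀ = -b₀
  · -- then `n = 1`, `(a, b) ≠ (1, 1)`, `Dz` is odd, and the rows with their negatives give `14 ≤ 12`
    have hn1 : n = 1 := by
      have h2 : (2 : ZMod n) * b₀ = 0 := by rw [two_mul]; nth_rewrite 2 [hbb]; rw [add_neg_cancel]
      have h2' : ((2 : ℕ) : ZMod n) = 0 := by
        have := hb₀.mul_left_eq_zero.mp h2
        exact_mod_cast this
      rw [ZMod.natCast_eq_zero_iff] at h2'
      have hn2 : n ≤ 2 := Nat.le_of_dvd two_pos h2'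
      have hn0 : n ≠ 0 := NeZero.ne n
      have hn2' : n ≠ 2 := by
        rintro rfl
        have := hn5 2 (Nat.mem_primeFactors.mpr ⟨Nat.prime_two, dvd_rfl, two_ne_zero⟩)
        omega
      omega
    have hab : ¬ (a = 1 ∧ b = 1) := fun h ↦ habn ⟨h.1, h.2, hn1⟩
    have hm1 := mul_ne_neg_one_of_ker ha hb hab hd₅ hd₇
    have hodd : ∀ u : (ZMod (5 ^ a * 7 ^ b))ˣ, Dz (-(u : ZMod (5 ^ a * 7 ^ b))) = -Dz (u : ZMod (5 ^ a * 7 ^ b)) := by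
      intro u
      simp only [hDz]
      rw [show ((-(u : ZMod (5 ^ a * 7 ^ b))), b₀) = (-(u : ZMod (5 ^ a * 7 ^ b)), -b₀) by rw [← hbb],
        crt_symm_neg, neg_neg]
      ring
    have htwo := two_mul_sum_three_rows_le_sum_abs Dz hd₅ hd₇ hkk (fun u v hu hv ↦ hm1 u v hu hv) hodd
      y u₁ u₂ hu₁ hu₂ker hu₁1 h02 h12
    have hmass : ((∑ y' : ZMod (5 ^ a * 7 ^ b), (F (crt[hc, y', b₀]) + F (-(crt[hc, y', b₀]))) : ℕ) : ℤ) ≤ 12 := by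
      have := hfib₂; omega
    linarith
  · -- `b₀ ≠ -b₀`: the two fibres are disjoint, the three rows carry at most `Σ F ≤ 6`
    have hthree := sum_three_rows_le_sum_abs Dz hd₅ hd₇ hkk y u₁ u₂ hu₁ hu₂ker hu₁1 h02 h12
    have hmass : ((∑ y' : ZMod (5 ^ a * 7 ^ b), (F (crt[hc, y', b₀]) + F (-(crt[hc, y', b₀]))) : ℕ) : ℤ) ≤ 6 := by
      have := hfib₁ hbb; omega
    linarith

/-- **Even, or a progression fibre at `5` or at `7` (the twin boundary brick, internal form).** Let
`T : ℤ/(5^a7^bn) → ℂ` (`a, b ≥ 1`, `(a, b, n) ≠ (1, 1, 1)`, primes of `n` `≥ 5`, `5^a7^b ⊥ n`) take values in `ℕ`,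
vanish off the units, be annihilated by every odd primitive character, have room `#supp T + 1 < p'` at every prime
`p' ∣ n`, and total mass `Σ T ≤ 6`. Then `T` is even, or for `p₁ = 5` or `p₁ = 7` all but at most one of the `p₁`
points `x₀ + j (5^a7^bn/p₁)` through some unit `x₀` lie in `supp T`. (Cut the piece of `T` around a unit `z₀` with
`T(z₀) ≠ T(−z₀)` and apply `progression_of_pos_diff` at `(y₀, b₀) = z₀` or at `(−y₀, −b₀) = −z₀`, whichever has the
positive difference.) [cite: Aoki1983, Prop. 6.4 and §9] -/
theorem even_or_progression_of_boundary_twin [NeZero (5 ^ a * 7 ^ b)] (ha : 1 ≤ a) (hb : 1 ≤ b)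
    (habn : ¬ (a = 1 ∧ b = 1 ∧ n = 1)) (hn5 : ∀ p' ∈ n.primeFactors, 5 ≤ p') (hc : (5 ^ a * 7 ^ b).Coprime n)
    (T : ZMod (5 ^ a * 7 ^ b * n) → ℂ) (hN : ∀ z, ∃ k : ℕ, T z = k) (hTu : ∀ z, ¬ IsUnit z → T z = 0)
    (hT : ∀ χ : DirichletCharacter ℂ (5 ^ a * 7 ^ b * n), χ.Odd → χ.IsPrimitive →
      ∑ z : ZMod (5 ^ a * 7 ^ b * n), T z * χ z = 0)
    (hroom : ∀ p' ∈ n.primeFactors, #(univ.filter fun z : ZMod (5 ^ a * 7 ^ b * n) ↦ T z ≠ 0) + 1 < p')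
    (hmass : ∃ k : ℕ, k ≤ 6 ∧ ∑ z : ZMod (5 ^ a * 7 ^ b * n), T z = k) :
    (∀ z, T (-z) = T z) ∨ ∃ p₁ : ℕ, (p₁ = 5 ∨ p₁ = 7) ∧ ∃ x₀ : ZMod (5 ^ a * 7 ^ b * n), IsUnit x₀ ∧
      ∃ j₀ : ℕ, j₀ < p₁ ∧ ∀ j : ℕ, j < p₁ → j ≠ j₀ →
        T (x₀ + (j : ZMod (5 ^ a * 7 ^ b * n)) * ((5 ^ a * 7 ^ b * n / p₁ : ℕ) : ZMod (5 ^ a * 7 ^ b * n))) ≠ 0 := by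
  classical
  haveI : NeZero (5 ^ a * 7 ^ b * n) := ⟨mul_ne_zero (NeZero.ne _) (NeZero.ne n)⟩
  have hq₀odd : Odd (5 ^ a * 7 ^ b) := (Odd.pow (by decide : Odd 5)).mul (Odd.pow (by decide : Odd 7))
  have hq₀5 : 5 ≤ 5 ^ a * 7 ^ b :=
    le_trans (Nat.le_self_pow (by omega) 5) (Nat.le_mul_of_pos_right _ (by positivity))
  by_cases hev : ∀ z, T (-z) = T z
  · exact Or.inl hev
  right
  push Not at hev
  obtain ⟨z₀, hz₀⟩ := hev
  have hz₀u : IsUnit z₀ := by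
    by_contra hnu
    exact hz₀ (by rw [hTu z₀ hnu, hTu (-z₀) (fun h ↦ hnu (by simpa using h.neg))])
  -- natural values and the piece of `T` around `z₀`
  choose kT hkT using hN
  have hTpann := piece_annihilated_odd hq₀odd hq₀5 hc hn5 T hTu hT hroom hz₀u n.primeFactors (subset_refl _)
  set F : ZMod (5 ^ a * 7 ^ b * n) → ℕ := fun z ↦ if Reg[n.primeFactors, z₀, z] then kT z else 0 with hF
  have hFval : ∀ z, (F z : ℂ) = if Reg[n.primeFactors, z₀, z] then T z else 0 := by
    intro z
    by_cases hreg : Reg[n.primeFactors, z₀, z]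
    · simp only [hF, if_pos hreg, hkT z]
    · simp only [hF, if_neg hreg, Nat.cast_zero]
  have hFann : ∀ χ : DirichletCharacter ℂ (5 ^ a * 7 ^ b * n), χ.Odd → χ.IsPrimitive →
      ∑ z : ZMod (5 ^ a * 7 ^ b * n), (F z : ℂ) * χ z = 0 := by
    intro χ hχ hprim
    simp only [hFval]
    exact hTpann χ hχ hprim
  have hFreg : ∀ z, F z ≠ 0 → Reg[n.primeFactors, z₀, z] ∧ F z = kT z := by
    intro z hz
    by_cases hreg : Reg[n.primeFactors, z₀, z]
    · exact ⟨hreg, by simp only [hF, if_pos hreg]⟩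
    · exact absurd (by simp only [hF, if_neg hreg]) hz
  have hFsupp : ∀ z, (F z : ℂ) ≠ 0 → IsUnit z ∧ Reg[n.primeFactors, z₀, z] := by
    intro z hz
    have hz' : F z ≠ 0 := by exact_mod_cast hz
    obtain ⟨hreg, hFk⟩ := hFreg z hz'
    refine ⟨?_, hreg⟩
    by_contra hnu
    have h0 := hTu z hnu
    rw [hkT z, Nat.cast_eq_zero] at h0
    exact hz' (by rw [hFk, h0])
  have hFT : ∀ z, F z ≠ 0 → T z ≠ 0 := by
    intro z hz
    obtain ⟨-, hFk⟩ := hFreg z hz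
    rw [hkT z, Nat.cast_ne_zero, ← hFk]
    exact hz
  have hFmass : ∑ z : ZMod (5 ^ a * 7 ^ b * n), F z ≤ 6 := by
    obtain ⟨k, hk6, hk⟩ := hmass
    have hsum : ∑ z : ZMod (5 ^ a * 7 ^ b * n), kT z = k := by
      have h : ((∑ z : ZMod (5 ^ a * 7 ^ b * n), kT z : ℕ) : ℂ) = (k : ℂ) := by
        rw [Nat.cast_sum, ← hk]
        exact Finset.sum_congr rfl fun z _ ↦ (hkT z).symm
      exact_mod_cast h
    have hle : ∑ z : ZMod (5 ^ a * 7 ^ b * n), F z ≤ ∑ z : ZMod (5 ^ a * 7 ^ b * n), kT z := by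
      refine Finset.sum_le_sum fun z _ ↦ ?_
      by_cases hreg : Reg[n.primeFactors, z₀, z]
      · simp only [hF, if_pos hreg, le_rfl]
      · simp only [hF, if_neg hreg, Nat.zero_le]
    omega
  have hregz₀ : Reg[n.primeFactors, z₀, z₀] := fun p' _ ↦ Or.inl rfl
  have hregnz₀ : Reg[n.primeFactors, z₀, -z₀] := fun p' _ ↦ Or.inr (by rw [map_neg])
  have hFz₀ : F z₀ = kT z₀ := by simp only [hF, if_pos hregz₀]
  have hFnz₀ : F (-z₀) = kT (-z₀) := by simp only [hF, if_pos hregnz₀]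
  -- coordinates of `z₀`
  set y₀u : (ZMod (5 ^ a * 7 ^ b))ˣ := (hz₀u.map (ZMod.castHom (dvd_mul_right (5 ^ a * 7 ^ b) n) (ZMod (5 ^ a * 7 ^ b)))).unit
    with hy₀u
  set b₀ : ZMod n := ZMod.castHom (dvd_mul_left n (5 ^ a * 7 ^ b)) (ZMod n) z₀
  have hb₀u : IsUnit b₀ := hz₀u.map _
  have hz₀eq : crt[hc, (y₀u : ZMod (5 ^ a * 7 ^ b)), b₀] = z₀ := by
    rw [hy₀u, IsUnit.unit_spec]; exact crt_symm_castHom hc z₀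
  have hnz₀eq : crt[hc, (((-y₀u : (ZMod (5 ^ a * 7 ^ b))ˣ)) : ZMod (5 ^ a * 7 ^ b)), -b₀] = -z₀ := by
    rw [Units.val_neg, crt_symm_neg, hz₀eq]
  have hne : kT z₀ ≠ kT (-z₀) := by
    intro h; exact hz₀ (by rw [hkT, hkT, h])
  -- the positive difference sits at `z₀` or at `-z₀`
  have hconv : ∀ {p₁ : ℕ} {x₀ : ZMod (5 ^ a * 7 ^ b * n)} {j₀ : ℕ},
      (∀ j : ℕ, j < p₁ → j ≠ j₀ →
        F (x₀ + (j : ZMod (5 ^ a * 7 ^ b * n)) * ((5 ^ a * 7 ^ b * n / p₁ : ℕ) : ZMod (5 ^ a * 7 ^ b * n))) ≠ 0) →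
      ∀ j : ℕ, j < p₁ → j ≠ j₀ →
        T (x₀ + (j : ZMod (5 ^ a * 7 ^ b * n)) * ((5 ^ a * 7 ^ b * n / p₁ : ℕ) : ZMod (5 ^ a * 7 ^ b * n))) ≠ 0 :=
    fun h j hj hjne ↦ hFT _ (h j hj hjne)
  rcases Nat.lt_or_gt_of_ne hne with hlt | hlt
  · -- `T z₀ < T(-z₀)`: positive difference at `-z₀ = crt⁻¹(-y₀, -b₀)`
    have hpos : F (-(crt[hc, (((-y₀u : (ZMod (5 ^ a * 7 ^ b))ˣ)) : ZMod (5 ^ a * 7 ^ b)), -b₀])) <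
        F (crt[hc, (((-y₀u : (ZMod (5 ^ a * 7 ^ b))ˣ)) : ZMod (5 ^ a * 7 ^ b)), -b₀]) := by
      rw [hnz₀eq, neg_neg, hFz₀, hFnz₀]; exact hlt
    obtain ⟨p₁, hp57, x₀, hx₀, j₀, hj₀, hprog⟩ :=
      progression_of_pos_diff ha hb habn hn5 hc F hFann hz₀u hFsupp hFmass (-b₀) hb₀u.neg (-y₀u) hpos
    exact ⟨p₁, hp57, x₀, hx₀, j₀, hj₀, hconv hprog⟩
  · -- `T(-z₀) < T z₀`: positive difference at `z₀ = crt⁻¹(y₀, b₀)`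
    have hpos : F (-(crt[hc, (y₀u : ZMod (5 ^ a * 7 ^ b)), b₀])) < F (crt[hc, (y₀u : ZMod (5 ^ a * 7 ^ b)), b₀]) := by
      rw [hz₀eq, hFz₀, hFnz₀]; exact hlt
    obtain ⟨p₁, hp57, x₀, hx₀, j₀, hj₀, hprog⟩ :=
      progression_of_pos_diff ha hb habn hn5 hc F hFann hz₀u hFsupp hFmass b₀ hb₀u y₀u hpos
    exact ⟨p₁, hp57, x₀, hx₀, j₀, hj₀, hconv hprog⟩

end Twin

/-- **T6-L1 `stub_fibre_of_boundary_twin`** (registered form of `even_or_progression_of_boundary_twin`, at the level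
written as `5^a · (7^b · n)` — the shape the level analysis produces). [cite: Aoki1983, Prop. 6.4 and §9] -/
theorem stub_fibre_of_boundary_twin : ∀ (a b n : ℕ) [NeZero n], 1 ≤ a → 1 ≤ b → ¬ (a = 1 ∧ b = 1 ∧ n = 1) → (∀ p' ∈ n.primeFactors, 5 ≤ p') → (5 ^ a * 7 ^ b).Coprime n → ∀ (T : ZMod (5 ^ a * (7 ^ b * n)) → ℂ), (∀ z, ∃ k : ℕ, T z = k) → (∀ z, ¬ IsUnit z → T z = 0) → (∀ χ : DirichletCharacter ℂ (5 ^ a * (7 ^ b * n)), χ.Odd → χ.IsPrimitive → ∑ z : ZMod (5 ^ a * (7 ^ b * n)), T z * χ z = 0) → (∀ p' ∈ n.primeFactors, #(univ.filter fun z : ZMod (5 ^ a * (7 ^ b * n)) ↦ T z ≠ 0) + 1 < p') → (∃ k : ℕ, k ≤ 6 ∧ ∑ z : ZMod (5 ^ a * (7 ^ b * n)), T z = k) → (∀ z, T (-z) = T z) ∨ ∃ p₁ : ℕ, (p₁ = 5 ∨ p₁ = 7) ∧ ∃ x₀ : ZMod (5 ^ a * (7 ^ b * n)), IsUnit x₀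 ∧ ∃ j₀ : ℕ, j₀ < p₁ ∧ ∀ j : ℕ, j < p₁ → j ≠ j₀ → T (x₀ + (j : ZMod (5 ^ a * (7 ^ b * n))) * ((5 ^ a * (7 ^ b * n) / p₁ : ℕ) : ZMod (5 ^ a * (7 ^ b * n)))) ≠ 0 := by
  intro a b n _ ha hb habn hn5 hc T hN hTu hT hroom hmass
  have key : ∀ (N : ℕ) [NeZero N] (_ : N = 5 ^ a * 7 ^ b * n) (T : ZMod N → ℂ), (∀ z, ∃ k : ℕ, T z = k) →
      (∀ z, ¬ IsUnit z → T z = 0) →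
      (∀ χ : DirichletCharacter ℂ N, χ.Odd → χ.IsPrimitive → ∑ z : ZMod N, T z * χ z = 0) →
      (∀ p' ∈ n.primeFactors, #(univ.filter fun z : ZMod N ↦ T z ≠ 0) + 1 < p') →
      (∃ k : ℕ, k ≤ 6 ∧ ∑ z : ZMod N, T z = k) →
      (∀ z, T (-z) = T z) ∨ ∃ p₁ : ℕ, (p₁ = 5 ∨ p₁ = 7) ∧ ∃ x₀ : ZMod N, IsUnit x₀ ∧ ∃ j₀ : ℕ, j₀ < p₁ ∧
        ∀ j : ℕ, j < p₁ → j ≠ j₀ → T (x₀ + (j : ZMod N) * ((N / p₁ : ℕ) : ZMod N)) ≠ 0 := by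
    intro N _ hNeq T' hN' hTu' hT' hroom' hmass'
    subst hNeq
    haveI : NeZero (5 ^ a * 7 ^ b) := ⟨by positivity⟩
    exact even_or_progression_of_boundary_twin ha hb habn hn5 hc T' hN' hTu' hT' hroom' hmass'
  exact key (5 ^ a * (7 ^ b * n)) (Nat.mul_assoc _ _ _).symm T hN hTu hT hroom hmass

end PairedNull

end Summit.HodgeConjecture.HodgeConjecture.Theorems.CancelByAnyClaimLattice
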